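import Literature.Probability.LatticeModels.CriticalBlockMoments
import HarnessLib

/-!
# S4 of line `Sketch` of crux `SubPtolemyFloor` (item stmt-CriticalPhenomena-15703, route
# `SubPtolemyInterlacing`): block-spin tail floor ⇒ block pair-sum floor

THEOREM-ONLY file (no definitions, no named facts). Write `G = criticalTwoPoint 3` for the critical
two-point function `⟨σ₀σ_x⟩⁺_{β_c}` of the nearest-neighbour Ising model on `ℤ³`, `Λ_n = box 3 n`,
`M_n = Σ_{x ∈ Λ_n} σ_x` (block spin) and `B_n = Σ_{a,b ∈ Λ_n} G(b - a)`.

**Theorem** (`stub_boxPairFloorOfBlockTail`). If for some `p₀ ∈ (0,1)` the critical plus state gives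
`⟨𝟙{n^{3-u} ≤ M_n}⟩⁺_{β_c} ≥ p₀` for every `n ≥ 1`, then `B_n ≥ c n^{6-2u}` for every `n ≥ 1` with
some `c > 0` (in fact `c = p₀`).

**Proof.** The plus state at `β_c` is the integral against a probability measure `μ` on `{±1}^{ℤ³}`
whose spin correlations are the plus correlations (`exists_isProbabilityMeasure_spinCorr_eq_plusCorr`,
`plusExpect_spinFun_eq_integral`: both `𝟙{t ≤ M_n}` and `M_n²` are functions of the finitely many
spins in `Λ_n`). Chebyshev: for `t > 0`, `𝟙{t ≤ M_n} ≤ M_n²/t²` pointwise, so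
`⟨𝟙{t ≤ M_n}⟩⁺ ≤ ⟨M_n²⟩⁺/t²`; and `⟨M_n²⟩⁺ = Σ_{a,b ∈ Λ_n} ⟨σ_aσ_b⟩_{β_c}`
(`plusExpect_blockSpin_sq_eq_sum`) `= B_n` by translation invariance (`criticalCorr_two_pair`). With
`t = n^{3-u}` the hypothesis gives `p₀ ≤ B_n / n^{6-2u}`.

The sharper constant `1/(2 log(1/p₀))` of the sub-Gaussian (Newman / GHS, Lee–Yang) tail bound
`⟨𝟙{t ≤ M_n}⟩ ≤ exp(-t²/(2B_n))` [Newman1975, Theorem 4] is not needed for the existential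
conclusion; the second-moment bound already yields the stated power floor.

References: C. M. Newman, Z. Wahrsch. verw. Gebiete 33 (1975) (context); S. Friedli, Y. Velenik,
*Statistical Mechanics of Lattice Systems* (CUP 2017), Thm. 3.17, Thm. 6.26 (the plus state as a
Gibbs measure).
-/

namespace Summit.CriticalPhenomena.Ising3DConformalLimit.SubPtolemyFloorSketch

open scoped BigOperators Classical
open Finset Literature.Probability.LatticeModels
open MeasureTheory Literature.Barriers.CriticalPhenomena

/-! ### Chebyshev for the critical block spin -/

/-- The block spin is bounded by the volume: `|M_L| ≤ |Λ_L|`, hence `M_L² / t² ≤ |Λ_L|² / t²`.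
[folklore] -/
theorem blockTail_sq_div_le (d L : ℕ) (t : ℝ) (σ : SpinConfig (Site d)) :
    (∑ x ∈ box d L, spinAt x σ) ^ 2 / t ^ 2 ≤ ((box d L).card : ℝ) ^ 2 / t ^ 2 := by
  have h1 : |∑ x ∈ box d L, spinAt x σ| ≤ ((box d L).card : ℝ) := by
    calc |∑ x ∈ box d L, spinAt x σ| ≤ ∑ x ∈ box d L, |spinAt x σ| :=
          Finset.abs_sum_le_sum_abs _ _
      _ = ((box d L).card : ℝ) := by simp
  have h2 : (∑ x ∈ box d L, spinAt x σ) ^ 2 ≤ ((box d L).card : ℝ) ^ 2 := by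
    rw [← sq_abs]
    exact pow_le_pow_left₀ (abs_nonneg _) h1 2
  exact div_le_div_of_nonneg_right h2 (sq_nonneg t)

/-- **Chebyshev in the critical plus state**: for `t > 0`,
`⟨𝟙{t ≤ M_L}⟩⁺_{β_c} ≤ B_L / t²` with `B_L = Σ_{a,b ∈ Λ_L} ⟨σ₀σ_{b-a}⟩⁺_{β_c} = ⟨M_L²⟩⁺_{β_c}`
(plus state = integral against a plus Gibbs measure on local observables; translation invariance).
[cite: FriedliVelenik2017, Thm. 3.17 and Thm. 6.26] -/
theorem plusExpect_blockTail_le_pairSum_div (d L : ℕ) {t : ℝ} (ht : 0 < t) :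
    plusExpect d (criticalBeta d) 0
        (fun σ => if t ≤ ∑ x ∈ box d L, spinAt x σ then 1 else 0) ≤
      (∑ a ∈ box d L, ∑ b ∈ box d L, criticalTwoPoint d (b - a)) / t ^ 2 := by
  obtain ⟨μ, hμP, hμ⟩ :=
    exists_isProbabilityMeasure_spinCorr_eq_plusCorr d (criticalBeta_nonneg d)
  -- the tail probability as an integral
  have key₁ := plusExpect_spinFun_eq_integral (criticalBeta_nonneg d) le_rfl hμ (box d L)
    (fun s => if t ≤ ∑ x ∈ box d L, s x then (1 : ℝ) else 0)
    (fun s s' hss' => by rw [Finset.sum_congr rfl hss'])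
  have e₁ : (fun σ : SpinConfig (Site d) => if t ≤ ∑ x ∈ box d L, spinAt x σ then (1 : ℝ) else 0) =
      fun σ => (fun s : Site d → ℝ => if t ≤ ∑ x ∈ box d L, s x then (1 : ℝ) else 0)
        fun x => spinAt x σ := rfl
  -- the second moment as an integral, and as the pair sum
  have key₂ := plusExpect_spinFun_eq_integral (criticalBeta_nonneg d) le_rfl hμ (box d L)
    (fun s => (∑ x ∈ box d L, s x) ^ 2) (fun s s' hss' => by rw [Finset.sum_congr rfl hss'])
  have e₂ : (fun σ : SpinConfig (Site d) => (∑ x ∈ box d L, spinAt x σ) ^ 2) =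
      fun σ => (fun s : Site d → ℝ => (∑ x ∈ box d L, s x) ^ 2) fun x => spinAt x σ := rfl
  have hB : ∫ σ, (∑ x ∈ box d L, spinAt x σ) ^ 2 ∂μ =
      ∑ a ∈ box d L, ∑ b ∈ box d L, criticalTwoPoint d (b - a) := by
    rw [← key₂, ← e₂, plusExpect_blockSpin_sq_eq_sum]
    exact Finset.sum_congr rfl fun a _ => Finset.sum_congr rfl fun b _ => criticalCorr_two_pair a b
  -- Chebyshev
  have hmeas : Measurable fun σ : SpinConfig (Site d) => (∑ x ∈ box d L, spinAt x σ) ^ 2 / t ^ 2 :=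
    ((Finset.measurable_sum _ fun x _ => measurable_spinAt x).pow_const 2).div_const _
  have hint : Integrable (fun σ : SpinConfig (Site d) => (∑ x ∈ box d L, spinAt x σ) ^ 2 / t ^ 2) μ :=
    Integrable.of_bound hmeas.aestronglyMeasurable (((box d L).card : ℝ) ^ 2 / t ^ 2)
      (Filter.Eventually.of_forall fun σ => by
        rw [Real.norm_eq_abs, abs_of_nonneg (by positivity)]
        exact blockTail_sq_div_le d L t σ)
  have hle : ∫ σ, (if t ≤ ∑ x ∈ box d L, spinAt x σ then (1 : ℝ) else 0) ∂μ ≤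
      ∫ σ, (∑ x ∈ box d L, spinAt x σ) ^ 2 / t ^ 2 ∂μ := by
    refine integral_mono_of_nonneg (Filter.Eventually.of_forall fun σ => ?_) hint
      (Filter.Eventually.of_forall fun σ => ?_)
    · by_cases h : t ≤ ∑ x ∈ box d L, spinAt x σ <;> simp [h]
    · dsimp only
      by_cases h : t ≤ ∑ x ∈ box d L, spinAt x σ
      · rw [if_pos h, one_le_div (pow_pos ht 2)]
        exact pow_le_pow_left₀ ht.le h 2
      · rw [if_neg h]
        positivity
  rw [e₁, key₁, ← hB, ← integral_div]
  exact hle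

/-! ### The stub -/

/-- **S4 — block-spin tail floor ⇒ block pair-sum floor** (card lee-yang-tail-transfer, first lemma;
registered stub `stub_boxPairFloorOfBlockTail` of line `Sketch`, crux `SubPtolemyFloor`).
If the critical plus state gives the one-sided block-spin tail `⟨𝟙{n^{3-u} ≤ M_n}⟩⁺_{β_c} ≥ p₀ ∈ (0,1)`
at every scale `n ≥ 1` (`M_n = Σ_{x∈Λ_n} σ_x`), then `B_n = Σ_{a,b ∈ Λ_n} ⟨σ₀σ_{b-a}⟩⁺_{β_c} ≥ c n^{6-2u}`
for all `n ≥ 1` with `c = p₀ > 0`: Chebyshev `⟨𝟙{t ≤ M_n}⟩⁺ ≤ ⟨M_n²⟩⁺/t²` at `t = n^{3-u}` and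
`⟨M_n²⟩⁺ = B_n` (`plusExpect_blockTail_le_pairSum_div`). (Newman's sub-Gaussian bound would give
the constant `1/(2 log(1/p₀))`; not needed.) [cite: Newman1975, Theorem 4, eq. (2.5)] -/
theorem stub_boxPairFloorOfBlockTail :
    ∀ u p₀ : ℝ, 0 < p₀ → p₀ < 1 →
      (∀ n : ℕ, 1 ≤ n →
        p₀ ≤ plusExpect 3 (criticalBeta 3) 0
          (fun σ => if (n : ℝ) ^ (3 - u) ≤ ∑ x ∈ box 3 n, spinAt x σ then 1 else 0)) →
      ∃ c : ℝ, 0 < c ∧ ∀ n : ℕ, 1 ≤ n →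
        c * (n : ℝ) ^ (6 - 2 * u) ≤ ∑ a ∈ box 3 n, ∑ b ∈ box 3 n, criticalTwoPoint 3 (b - a) := by
  intro u p₀ hp₀ _ hT
  refine ⟨p₀, hp₀, fun n hn => ?_⟩
  have hn0 : (0 : ℝ) < n := Nat.cast_pos.mpr hn
  have ht : (0 : ℝ) < (n : ℝ) ^ (3 - u) := Real.rpow_pos_of_pos hn0 _
  have ht2 : ((n : ℝ) ^ (3 - u)) ^ 2 = (n : ℝ) ^ (6 - 2 * u) := by
    rw [← Real.rpow_two, ← Real.rpow_mul hn0.le]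
    congr 1
    ring
  have h := (hT n hn).trans (plusExpect_blockTail_le_pairSum_div 3 n ht)
  rw [le_div_iff₀ (pow_pos ht 2), ht2] at h
  exact h

end Summit.CriticalPhenomena.Ising3DConformalLimit.SubPtolemyFloorSketch
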